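import Mathlib
import Summits.Ventures.PercRepro2.Defs
import Summits.Ventures.PercRepro2.Independence
import Summits.Ventures.PercRepro2.Harris
import Summits.Ventures.PercRepro2.CoinDefs
import Summits.Ventures.PercRepro2.CoinArcsOff
import Summits.Ventures.PercRepro2.CoinPendantDefs
import Summits.Ventures.PercRepro2.CoinPendant
import Summits.Ventures.PercRepro2.CoinInduced
import Summits.Ventures.PercRepro2.CoinVdBK
import Summits.Ventures.PercRepro2.CoinBHK
import Summits.Ventures.PercRepro2.CoinReverse
import Summits.Ventures.PercRepro2.CoinLemmaA
import Summits.Ventures.PercRepro2.CoinDarcMixed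
import Summits.Ventures.PercRepro2.CoinTwoPendantDefs
import Summits.Ventures.PercRepro2.CoinTwoPendantMass
import Summits.Ventures.PercRepro2.CoinTraceLevels
import Summits.Ventures.PercRepro2.CoinTraceTower
import Summits.Ventures.PercRepro2.CoinTracePin
import Summits.Ventures.PercRepro2.CoinTraceReduce
import Summits.Ventures.PercRepro2.CoinTraceFn
import Summits.Ventures.PercRepro2.CoinTraceBlock
import Summits.Ventures.PercRepro2.CoinTraceShift
import Summits.Ventures.PercRepro2.CoinTwoStarAbstract
import Summits.Ventures.PercRepro2.CoinTwoStar

/-!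
# The literal 2-STAR: four single-arc coins `w → v₁, w → v₂, v₁ → t, v₂ → t` (blind cell
PercRepro2, night-2 g3; proofs/NIGHT2-DARC.md §17.4)

`darc_of_twoStar_coins`: if the four star coins are the ONLY coins with tails in `{w, v₁, v₂}`
(`OnlyStarCoins`; entries into the star from outside are arbitrary single arcs, the rest of the
system is any `SameEnds` coin system), then the structural hypotheses of `darc_of_twoStar_mixed`
hold — closed out, pendant coins with tails in the star, the leaves decided by `e₃`, `e₄`, the head
reaching `t` only through the leaves — and row 2′DARC holds at the head `w`.
-/

namespace Summit.Ventures.PercRepro2.Coin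

section StarCoins

variable {V : Type*} {E : Type*} [DecidableEq V]

/-- The four star coins are the only coins carrying an arc with tail in `{w, v₁, v₂}`. -/
def OnlyStarCoins (arcs : E → Finset (V × V)) (w v₁ v₂ : V) (e₁ e₂ e₃ e₄ : E) : Prop :=
  ∀ e, (∃ xy ∈ arcs e, xy.1 = w ∨ xy.1 = v₁ ∨ xy.1 = v₂) → e = e₁ ∨ e = e₂ ∨ e = e₃ ∨ e = e₄

variable {arcs : E → Finset (V × V)} {w v₁ v₂ t : V} {e₁ e₂ e₃ e₄ : E}
  (h₁ : arcs e₁ = {(w, v₁)}) (h₂ : arcs e₂ = {(w, v₂)}) (h₃ : arcs e₃ = {(v₁, t)})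
  (h₄ : arcs e₄ = {(v₂, t)}) (honly : OnlyStarCoins arcs w v₁ v₂ e₁ e₂ e₃ e₄)

include h₁ h₂ h₃ h₄ honly

omit [DecidableEq V] in
/-- An arc with tail in the star is one of the four star arcs. -/
lemma star_arc {e : E} {x y : V} (hxy : (x, y) ∈ arcs e) (hx : x = w ∨ x = v₁ ∨ x = v₂) :
    (e = e₁ ∧ x = w ∧ y = v₁) ∨ (e = e₂ ∧ x = w ∧ y = v₂) ∨ (e = e₃ ∧ x = v₁ ∧ y = t) ∨
      (e = e₄ ∧ x = v₂ ∧ y = t) := by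
  rcases honly e ⟨(x, y), hxy, hx⟩ with rfl | rfl | rfl | rfl
  · rw [h₁, Finset.mem_singleton, Prod.mk.injEq] at hxy
    exact Or.inl ⟨rfl, hxy.1, hxy.2⟩
  · rw [h₂, Finset.mem_singleton, Prod.mk.injEq] at hxy
    exact Or.inr (Or.inl ⟨rfl, hxy.1, hxy.2⟩)
  · rw [h₃, Finset.mem_singleton, Prod.mk.injEq] at hxy
    exact Or.inr (Or.inr (Or.inl ⟨rfl, hxy.1, hxy.2⟩))
  · rw [h₄, Finset.mem_singleton, Prod.mk.injEq] at hxy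
    exact Or.inr (Or.inr (Or.inr ⟨rfl, hxy.1, hxy.2⟩))

/-- The star is closed out into `{t}`. -/
lemma star_closedOut : ClosedOut arcs {w, v₁, v₂} {t} := by
  intro e xy hxy hx
  simp only [Finset.mem_insert, Finset.mem_singleton] at hx
  rcases star_arc h₁ h₂ h₃ h₄ honly hxy hx with ⟨_, _, hy⟩ | ⟨_, _, hy⟩ | ⟨_, _, hy⟩ | ⟨_, _, hy⟩ <;>
    simp [hy]

/-- The star coins carry only arcs with tails in the star. -/
lemma star_tailCoinsIn : TailCoinsIn arcs {w, v₁, v₂} {t} := by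
  intro e he xy hxy
  obtain ⟨x'y', hx'y', hx'⟩ := he
  simp only [Finset.mem_insert, Finset.mem_singleton] at hx'
  rcases star_arc h₁ h₂ h₃ h₄ honly hx'y' hx' with ⟨rfl, _, _⟩ | ⟨rfl, _, _⟩ | ⟨rfl, _, _⟩ |
    ⟨rfl, _, _⟩
  · rw [h₁, Finset.mem_singleton] at hxy; subst hxy; simp
  · rw [h₂, Finset.mem_singleton] at hxy; subst hxy; simp
  · rw [h₃, Finset.mem_singleton] at hxy; subst hxy; simp
  · rw [h₄, Finset.mem_singleton] at hxy; subst hxy; simp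

omit h₁ h₂ h₄ honly in
/-- `e₃` is a pendant coin. -/
lemma star_e₃_mem : e₃ ∈ tailCoins arcs {w, v₁, v₂} :=
  ⟨(v₁, t), by rw [h₃]; exact Finset.mem_singleton_self _, by simp⟩

omit h₁ h₂ h₃ honly in
/-- `e₄` is a pendant coin. -/
lemma star_e₄_mem : e₄ ∈ tailCoins arcs {w, v₁, v₂} :=
  ⟨(v₂, t), by rw [h₄]; exact Finset.mem_singleton_self _, by simp⟩

omit [DecidableEq V] in
/-- The leaf `v₁` reaches `t` iff `e₃` is open (`v₁ ≠ t`, `w ≠ v₁`, `v₂ ≠ v₁`). -/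
lemma star_leaf₁ (hwv₁ : w ≠ v₁) (hv₁₂ : v₁ ≠ v₂) (hv₁t : v₁ ≠ t) :
    bwdEvent arcs v₁ {t} = openEdge e₃ := by
  ext ω
  simp only [bwdEvent, Set.mem_setOf_eq, Finset.mem_singleton, exists_eq_left, openEdge]
  constructor
  · intro h
    rcases Relation.ReflTransGen.cases_head h with heq | ⟨y, ⟨e, he, hxy⟩, _⟩
    · exact absurd heq hv₁t
    · rcases star_arc h₁ h₂ h₃ h₄ honly hxy (Or.inr (Or.inl rfl)) with ⟨_, hx, _⟩ | ⟨_, hx, _⟩ |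
        ⟨rfl, _, _⟩ | ⟨_, hx, _⟩
      · exact absurd hx.symm hwv₁
      · exact absurd hx.symm hwv₁
      · exact he
      · exact absurd hx hv₁₂
  · intro h
    exact reach_of_openArc ⟨e₃, h, by rw [h₃]; exact Finset.mem_singleton_self _⟩

omit [DecidableEq V] in
/-- The leaf `v₂` reaches `t` iff `e₄` is open. -/
lemma star_leaf₂ (hwv₂ : w ≠ v₂) (hv₁₂ : v₁ ≠ v₂) (hv₂t : v₂ ≠ t) :
    bwdEvent arcs v₂ {t} = openEdge e₄ := by
  ext ω
  simp only [bwdEvent, Set.mem_setOf_eq, Finset.mem_singleton, exists_eq_left, openEdge]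
  constructor
  · intro h
    rcases Relation.ReflTransGen.cases_head h with heq | ⟨y, ⟨e, he, hxy⟩, _⟩
    · exact absurd heq hv₂t
    · rcases star_arc h₁ h₂ h₃ h₄ honly hxy (Or.inr (Or.inr rfl)) with ⟨_, hx, _⟩ | ⟨_, hx, _⟩ |
        ⟨_, hx, _⟩ | ⟨rfl, _, _⟩
      · exact absurd hx.symm hwv₂
      · exact absurd hx.symm hwv₂
      · exact absurd hx.symm hv₁₂
      · exact he
  · intro h
    exact reach_of_openArc ⟨e₄, h, by rw [h₄]; exact Finset.mem_singleton_self _⟩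

omit [DecidableEq V] in
/-- The head reaches `t` only through a leaf. -/
lemma star_head_exit (hwv₁ : w ≠ v₁) (hwv₂ : w ≠ v₂) (hwt : w ≠ t) (ω : Config E)
    (h : ω ∈ bwdEvent arcs w {t}) : ω ∈ bwdEvent arcs v₁ {t} ∨ ω ∈ bwdEvent arcs v₂ {t} := by
  simp only [bwdEvent, Set.mem_setOf_eq, Finset.mem_singleton, exists_eq_left] at h ⊢
  rcases Relation.ReflTransGen.cases_head h with heq | ⟨y, ⟨e, _, hxy⟩, hyt⟩
  · exact absurd heq hwt
  · rcases star_arc h₁ h₂ h₃ h₄ honly hxy (Or.inl rfl) with ⟨_, _, rfl⟩ | ⟨_, _, rfl⟩ |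
      ⟨_, hx, _⟩ | ⟨_, hx, _⟩
    · exact Or.inl hyt
    · exact Or.inr hyt
    · exact absurd hx hwv₁
    · exact absurd hx hwv₂

end StarCoins

section Theorem

open Classical

variable {V : Type*} {E : Type*} [Fintype V] [DecidableEq V] [Fintype E] [DecidableEq E]
  {R : Type*} [Field R] [LinearOrder R] [IsStrictOrderedRing R]

/-- **THEOREM (the literal 2-star, row 2′DARC).** Coins `e₁ = {w → v₁}`, `e₂ = {w → v₂}`,
`e₃ = {v₁ → t}`, `e₄ = {v₂ → t}` are the only coins with tails in `{w, v₁, v₂}`; any probabilities;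
entries into the star and the rest of the system arbitrary (`SameEnds`); `t ∉ {w, v₁, v₂}`;
`a, b, u ∉ {w, v₁, v₂, t}`; the 16 reduced avoidance events of positive probability.  Then
`Φ_D({s ↛ t in D + (u → w)}) ≥ 0`. -/
theorem darc_of_twoStar_coins (p : E → R) (hp : IsProbVec p) {arcs : E → Finset (V × V)}
    (hS : SameEnds arcs) (s a b u w v₁ v₂ t : V) (hwv₁ : w ≠ v₁) (hwv₂ : w ≠ v₂)
    (hv₁₂ : v₁ ≠ v₂) (hwt : w ≠ t) (hv₁t : v₁ ≠ t) (hv₂t : v₂ ≠ t) {e₁ e₂ e₃ e₄ : E}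
    (h₁ : arcs e₁ = {(w, v₁)}) (h₂ : arcs e₂ = {(w, v₂)}) (h₃ : arcs e₃ = {(v₁, t)})
    (h₄ : arcs e₄ = {(v₂, t)}) (honly : OnlyStarCoins arcs w v₁ v₂ e₁ e₂ e₃ e₄)
    (ha : a ∉ ({w, v₁, v₂} : Finset V) ∪ {t}) (hb : b ∉ ({w, v₁, v₂} : Finset V) ∪ {t})
    (hu : u ∉ ({w, v₁, v₂} : Finset V) ∪ {t})
    (hP : ∀ Z ∈ ({w, v₁, v₂} : Finset V).powerset,
      0 < prob p (avoidEvent (arcsOff arcs ({w, v₁, v₂} ∪ {t})) s (Z ∪ {t})))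
    (hQ : ∀ Z ∈ ({w, v₁, v₂} : Finset V).powerset,
      0 < prob p (avoidEvent (arcsOff arcs ({w, v₁, v₂} ∪ {t})) s (gateTarget u w Z {t}))) :
    DARC p arcs s {t} a b u w :=
  darc_of_twoStar_mixed p hp hS s a b u w v₁ v₂ t hwv₁ hwv₂ hv₁₂
    (star_closedOut h₁ h₂ h₃ h₄ honly) (star_tailCoinsIn h₁ h₂ h₃ h₄ honly)
    (star_e₃_mem h₃) (star_leaf₁ h₁ h₂ h₃ h₄ honly hwv₁ hv₁₂ hv₁t)
    (star_e₄_mem h₄) (star_leaf₂ h₁ h₂ h₃ h₄ honly hwv₂ hv₁₂ hv₂t)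
    (star_head_exit h₁ h₂ h₃ h₄ honly hwv₁ hwv₂ hwt) ha hb hu hP hQ

end Theorem

end Summit.Ventures.PercRepro2.Coin
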